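import Literature.NumberTheory.Automorphic.LanglandsTunnellModThree
import Literature.NumberTheory.Automorphic.TunnellOctahedralGlobal
import Literature.NumberTheory.Automorphic.TunnellLemma
import Literature.NumberTheory.Automorphic.LanglandsTetrahedral
import Literature.NumberTheory.Automorphic.StrongArtinGL2WeightOneDictionary
import Literature.NumberTheory.Automorphic.BaseChangeArchimedean
import Literature.NumberTheory.Automorphic.BCDTModularity
import HarnessLib

/-!
# stub-ideation k2 · generation 17 · `stub_modThree` — companion sketch (PLAN C: μ₃-BLIND DESCENT)

Nothing registered.  Statements of the helper lemmas of `STUB-IDEAS-stub_modThree-2.md` (g17,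
PLAN C), the three algebraic kernels PROVED (`map_eq_one_of_pow_three`, `blindPair_map`,
`blindShape_of_cube_eq`) and the end-assembly `isModular_of_planC` PROVED from the typed helpers.

PLAN C develops probe T9 of g13 (`cubeRootOfUnity_eq_one_of_charP_three`: cube roots of unity die
in characteristic `3`) into a road: in the tree's Langlands–Tunnell assembly the `GL₃` leaves
`GelbartJacquet_adjoint_lift` + `JacquetShalika_eq_of_rsData_eq` serve only to remove the
cubic-twist ambiguity `t ↦ {a ζ, b ζ⁻¹}` (`ζ³ = 1`) of the cubic descent at the places of
`E = ℚ(√-3)` inert in `M` (Gelbart 1997 §7.1 (b)); for the MOD-3 target `ρ.IsModular` this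
ambiguity is invisible, so the descent may be run "blind" (`IsCubicBlindPiOfArtinRep`), provided
(i) the blind descent is still Galois-stable (`SigFibresCyclicPrime` + `SigBlindDescentGaloisStable`),
(ii) weight one is read through the archimedean-typed dictionary `AutomorphicRepData.IsOfWeightOne`
(`SigArchParamOfTower`, `SigArchParamTop`, `SigIsOfWeightOneOfBlind`) instead of Gelbart's Prop. 4.2
(which needs a.e. EXACT `π = π(σ)`), and (iii) the newform is compared with `ρ̄` by
Deligne–Serre + Chebotarev + Brauer–Nesbitt (`SigIsModularOfBlindNewform`).
-/

set_option linter.dupNamespace false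

noncomputable section

namespace Summit.ABC.ABC.Cruxes.FreyModularity.StubModThreeIdeasK2G17

open Literature.NumberTheory Literature.NumberTheory.Automorphic
open Literature.NumberTheory.GaloisRepresentations
open IsDedekindDomain Polynomial
open scoped MatrixGroups NumberField Polynomial Classical ModularForm
open CongruenceSubgroup EllipticCurves.ModularForms Rat.HeightOneSpectrum

/-- The registered stub `stub_modThree`, verbatim (Lines/Sketch.lean l.143). -/
def SigStubModThree : Prop :=
  ∀ (W : WeierstrassCurve ℚ) [W.IsElliptic] (ρ : ModPGaloisRep ℚ (ZMod 3) 2),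
    W.IsTorsionGaloisRep 3 ρ → FramedRep.IsAbsolutelyIrreducible ρ → ρ.IsModular

/-! ### C1–C2: the algebraic kernels (PROVED) -/

/-- **C1a.** A cube root of unity maps to `1` in any field of characteristic `3`
(`z³ - 1 = (z - 1)³` there).  Re-proof of g13's `cubeRootOfUnity_eq_one_of_charP_three` along a
ring map (the reduction `ℤ̄ → ℤ̄/𝔓`, `𝔓 ∣ 3`). -/
theorem map_eq_one_of_pow_three {R k : Type*} [CommRing R] [Field k] [CharP k 3] (f : R →+* k)
    {z : R} (hz : z ^ 3 = 1) : f z = 1 := by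
  haveI : Fact (Nat.Prime 3) := ⟨Nat.prime_three⟩
  have h3 : (f z) ^ 3 = 1 := by rw [← map_pow, hz, map_one]
  have h : (f z - 1) ^ 3 = 0 := by
    rw [sub_pow_char (p := 3) (f z) 1, h3, one_pow, sub_self]
  exact sub_eq_zero.mp (pow_eq_zero_iff (by norm_num) |>.mp h)

/-- **C1b (the μ₃-blindness of the mod-3 target).** If the Satake pair `{s, t}` differs from the
Frobenius eigenvalue pair `{a, b}` by cube roots of unity, `s = a z`, `t = b z'` (`z³ = z'³ = 1`),
then trace and determinant agree after ANY map to a field of characteristic `3`: the characteristic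
polynomials `X² - (s+t) X + s t` and `X² - (a+b) X + a b` have the same reduction. -/
theorem blindPair_map {R k : Type*} [CommRing R] [Field k] [CharP k 3] (f : R →+* k)
    {a b z z' : R} (hz : z ^ 3 = 1) (hz' : z' ^ 3 = 1) :
    f (a * z + b * z') = f (a + b) ∧ f (a * z * (b * z')) = f (a * b) := by
  have h1 := map_eq_one_of_pow_three f hz
  have h2 := map_eq_one_of_pow_three f hz'
  constructor
  · simp [map_add, map_mul, h1, h2]
  · simp [map_mul, h1, h2]

/-- **C2 (local shape of a blind cubic descent at a place inert in `M/E`).** If `s³ = a³` and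
`s t = a b` with `a ≠ 0` (what `IsWeakBaseChangeLiftAE` to the cubic `M` and the determinant clause
of `exists_cuspidal_descent_det_cubic` give at an inert place, residue degree `3`), then
`{s, t} = {a ζ, b ζ⁻¹}` for a cube root of unity `ζ`. -/
theorem blindShape_of_cube_eq {F : Type*} [Field F] {s t a b : F} (ha : a ≠ 0)
    (h3 : s ^ 3 = a ^ 3) (hdet : s * t = a * b) :
    ∃ z : F, z ^ 3 = 1 ∧ s = a * z ∧ t * z = b := by
  refine ⟨s / a, ?_, ?_, ?_⟩
  · rw [div_pow, h3, div_self (pow_ne_zero 3 ha)]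
  · rw [mul_div_cancel₀ s ha]
  · have hs : s ≠ 0 := by
      rintro rfl
      exact ha (pow_eq_zero_iff (n := 3) (by norm_num) |>.mp (by simpa using h3.symm))
    field_simp
    linear_combination hdet

/-! ### The blind relation -/

variable {F : Type} [Field F] [NumberField F]

/-- **`π = π(σ)` up to cube roots of unity at `v`**: `π` has a Satake parameter `{a z, b z'}` at `v`
with `z³ = z'³ = 1`, `z z' = 1`, where `{a, b}` are the Frobenius eigenvalues of the unramified `σ`
at `v`.  The exact relation `FrobSatakeCompatibleAt σ π v` is the case `z = z' = 1`. -/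
def IsCubicBlindAt {hcpt : isCompact_glFiniteIntegralLevel 2 F} (σ : FramedArtinRep F 2)
    (π : AutomorphicRepData (AutomorphyDatum.gl 2 F hcpt)) (v : HeightOneSpectrum (𝓞 F)) : Prop :=
  ∃ a b z z' : ℂ, π.HasSatakeParamAt v ({a * z, b * z'} : Multiset ℂ) ∧ σ.IsUnramifiedAt v ∧
    σ.HasFrobCharpolyAt v (satakePolynomial ({a, b} : Multiset ℂ)) ∧
      z ^ 3 = 1 ∧ z' ^ 3 = 1 ∧ z * z' = 1

/-- **`π = π(σ)` blind to cube roots of unity, almost everywhere** (the output currency of PLAN C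
over `ℚ`; compare `IsPiOfArtinRep σ π = ∀ᶠ v, FrobSatakeCompatibleAt σ π v`). -/
def IsCubicBlindPiOfArtinRep {hcpt : isCompact_glFiniteIntegralLevel 2 F} (σ : FramedArtinRep F 2)
    (π : AutomorphicRepData (AutomorphyDatum.gl 2 F hcpt)) : Prop :=
  ∀ᶠ v in Filter.cofinite, IsCubicBlindAt σ π v

/-- Exact implies blind (take `z = z' = 1`). -/
theorem IsCubicBlindAt.of_frobSatakeCompatibleAt {hcpt : isCompact_glFiniteIntegralLevel 2 F}
    {σ : FramedArtinRep F 2} {π : AutomorphicRepData (AutomorphyDatum.gl 2 F hcpt)}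
    {v : HeightOneSpectrum (𝓞 F)} (hcard : ∀ α, π.HasSatakeParamAt v α → Multiset.card α = 2)
    (h : FrobSatakeCompatibleAt σ π v) : IsCubicBlindAt σ π v := by
  obtain ⟨α, hα, hunr, hpoly⟩ := h
  have h2 := hcard α hα
  obtain ⟨a, b, rfl⟩ : ∃ a b, α = {a, b} := by
    rw [Multiset.card_eq_two] at h2
    exact h2
  exact ⟨a, b, 1, 1, by simpa using hα, hunr, hpoly, one_pow 3, one_pow 3, one_mul 1⟩

/-! ### C3–C4: Galois stability of the blind descent -/

/-- **C3 — fibres of cyclic base change of PRIME degree (unramified shadow).**  Arthur–Clozel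
1989, Ch. 3, Thm. 3.1 (with Thm. 4.2 (d)); Langlands 1980 (*Base change for GL(2)*) for `n = 2`:
for `M/K` cyclic of prime degree `ℓ` and `π, π'` cuspidal on `GL_n(𝔸_K)` with the same weak lift to
`M`, `π' ≃ π ⊗ ηⁱ` for a power of the class character `η` of `M/K`; shadow: the Satake parameters
differ a.e. by an `ℓ`-th root of unity `c(w) = ηⁱ(ϖ_w)`, equal to `1` at the places split in `M`.
The tree's leaf `ArthurClozel_fibres_quadratic` (`ha`) is the case `ℓ = 2` (`c = quadraticSign`);
PLAN C re-types the leaf at its printed generality and uses it at `ℓ = 2` AND `ℓ = 3`.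
[cite: ArthurClozelAMS120, Ch. 3 Thm. 3.1, Thm. 4.2 (d)] -/
def SigFibresCyclicPrime : Prop :=
  ∀ (n : ℕ) (K M : Type) [Field K] [NumberField K] [Field M] [NumberField M] [Algebra K M]
    [IsGalois K M], IsCyclic (M ≃ₐ[K] M) → (Module.finrank K M).Prime →
    ∀ (hK : isCompact_glFiniteIntegralLevel n K) (π π' : CuspidalAutomorphicRepData n K hK),
      (∀ᶠ x : HeightOneSpectrum (𝓞 M) in Filter.cofinite,
        ∀ (w : HeightOneSpectrum (𝓞 K)) (α α' : Multiset ℂ), x.asIdeal.under (𝓞 K) = w.asIdeal →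
          π.1.HasSatakeParamAt w α → π'.1.HasSatakeParamAt w α' →
            α.map (· ^ x.asIdeal.inertiaDeg (𝓞 K)) = α'.map (· ^ x.asIdeal.inertiaDeg (𝓞 K))) →
      ∃ c : HeightOneSpectrum (𝓞 K) → ℂ, (∀ w, c w ^ Module.finrank K M = 1) ∧
        (∀ w, (∃ x : HeightOneSpectrum (𝓞 M), x.asIdeal.under (𝓞 K) = w.asIdeal ∧
            x.asIdeal.inertiaDeg (𝓞 K) = 1) → c w = 1) ∧
        ∀ᶠ w : HeightOneSpectrum (𝓞 K) in Filter.cofinite, ∀ α : Multiset ℂ,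
          π.1.HasSatakeParamAt w α → π'.1.HasSatakeParamAt w (α.map (c w * ·))

/-- **C4 — the blind cubic descent is `Gal(E/ℚ)`-stable.**  Setting of PLAN C: `E/ℚ` quadratic,
`M/E` cyclic cubic with `M/ℚ` Galois (`Gal = S₃`), `P = π(σ_M)` EXACT on `GL₂(𝔸_M)`, `Π` a cuspidal
weak descent of `P` to `E` whose central character matches `det σ_E` a.e. (the output of
`exists_cuspidal_descent_det_cubic`).  Then `Π` has Galois-stable Satake data
(`IsGaloisStableSatakeAE ℚ Π.1`, the hypothesis of `cuspidal_descent_cyclic`).  Route (M): the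
Galois conjugate `Π^τ` is cuspidal with `t_{Π^τ, τ w} = t_{Π, w}` (tree, PROVED:
`CuspidalAutomorphicRepGL.galConj`, `HasSatakeParameterAt.galConj`; currency bridge to
`CuspidalAutomorphicRepData` to be checked), it is again a weak descent of `P^τ̃ = π(σ_M)` with the
same determinant (`σ_M`, `det σ_E` are restrictions from `ℚ`), so by C3 (`ℓ = 3`)
`t_{Π^τ} = c · t_Π` a.e. with `c³ = 1`, and comparing determinants `c² = 1`; hence `c = 1`.
In the tree's road this stability is free only AFTER the `GL₃` step makes `Π = π(σ_E)` exact. -/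
def SigBlindDescentGaloisStable : Prop :=
  ∀ (E M : Type) [Field E] [NumberField E] [Field M] [NumberField M] [Algebra E M] [IsGalois E M]
    [IsGalois ℚ M], Module.finrank ℚ E = 2 → Module.finrank E M = 3 →
    ∀ (σ : FramedArtinRep ℚ 2) (hE : isCompact_glFiniteIntegralLevel 2 E)
      (hM : isCompact_glFiniteIntegralLevel 2 M) (PiE : CuspidalAutomorphicRepData 2 E hE)
      (P : CuspidalAutomorphicRepData 2 M hM),
      IsPiOfArtinRep ((σ.restrictField E).restrictField M) P.1 → IsWeakBaseChangeLiftAE PiE.1 P.1 →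
      (∀ᶠ v : HeightOneSpectrum (𝓞 E) in Filter.cofinite, ∀ α β : Multiset ℂ,
          PiE.1.HasSatakeParamAt v α → (σ.restrictField E).HasFrobCharpolyAt v (satakePolynomial β) →
            α.prod = β.prod) →
      IsGaloisStableSatakeAE ℚ PiE.1

/-! ### C5: Tunnell's lemma with the hypothesis at the top field `M = E·K` -/

/-- **C5 — `tunnell_lemma` re-typed for the blind road.**  The tree's `tunnell_lemma` assumes
`IsPiOfArtinRep (σ.restrictField E) PE.1` (exact over `E`) and uses it only to know that the lift of
`PE` to `M = E·K` is `π(σ_M)`; since `E·K = M` IS the fixed field of `V₄` (`D₄ ∩ A₄ = V₄`), the blind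
road has this directly: `PE` lifts weakly to the exact `PM = π(σ_M)`.  Same conclusion, same proof
(`tunnell_lemma_of_fibres'` pattern) from `ArthurClozel_fibres_quadratic` over `K`. (M) -/
def SigTunnellLemmaTop : Prop :=
  ∀ (F E K M : Type) [Field F] [NumberField F] [Field E] [NumberField E] [Algebra F E]
    [Field K] [NumberField K] [Algebra F K] [Field M] [NumberField M] [Algebra F M] [Algebra E M]
    [Algebra K M] [IsScalarTower F E M] [IsScalarTower F K M],
    Module.finrank F E = 2 → Module.finrank F K = 3 → Module.finrank E M = 3 → Module.finrank K M = 2 →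
    ∀ (σ : FramedArtinRep F 2), IsOctahedralType σ.toMonoidHom →
      Nat.card (projectiveImage (σ.restrictField E).toMonoidHom) = 12 →
      Nat.card (projectiveImage (σ.restrictField K).toMonoidHom) = 8 →
    ∀ (hF : isCompact_glFiniteIntegralLevel 2 F) (hE : isCompact_glFiniteIntegralLevel 2 E)
      (hK : isCompact_glFiniteIntegralLevel 2 K) (hM : isCompact_glFiniteIntegralLevel 2 M)
      (PE : CuspidalAutomorphicRepData 2 E hE) (PK : CuspidalAutomorphicRepData 2 K hK)
      (PM : CuspidalAutomorphicRepData 2 M hM),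
      IsWeakBaseChangeLiftAE PE.1 PM.1 → IsPiOfArtinRep (σ.restrictField M) PM.1 →
      IsPiOfArtinRep (σ.restrictField K) PK.1 →
    ∀ (π₁ π₂ : CuspidalAutomorphicRepData 2 F hF),
      IsWeakBaseChangeLiftAE π₁.1 PE.1 → IsWeakBaseChangeLiftAE π₂.1 PE.1 →
      (∀ᶠ v : HeightOneSpectrum (𝓞 F) in Filter.cofinite, ∀ α : Multiset ℂ,
          π₁.1.HasSatakeParamAt v α → π₂.1.HasSatakeParamAt v (α.map (quadraticSign E v * ·))) →
      IsWeakBaseChangeLiftAE π₁.1 PK.1 ∨ IsWeakBaseChangeLiftAE π₂.1 PK.1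

/-! ### C6–C7: weight one through the archimedean parameter, not through Prop. 4.2 -/

/-- **C6a — the archimedean parameter descends the blind tower.**  `π` (over `ℚ`) lifts weakly to
`Π` (over the imaginary quadratic `E`), `Π` to `P` (over the cyclic cubic `M/E`); if `P` has
Harish-Chandra parameter `{0, 0}` at every embedding then so has `π`.  Route (M): `π` has SOME
parameter `χ` (`AutomorphicRepData.exists_hasArchParameter_gl`, PROVED), which lifts to `Π` and to `P`
by the tree's named fact `ArthurClozel1989_strongLifting_archimedean` (weak cuspidal lift along a
cyclic prime-degree extension ⇒ parameter `τ ↦ χ(τ|_F)`), and Harish-Chandra parameters are unique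
as multisets (`hasLieAction_unique` + the accepted `HasArchParameter`; to be checked in tree). -/
def SigArchParamOfTower : Prop :=
  ∀ (E M : Type) [Field E] [NumberField E] [Field M] [NumberField M] [Algebra E M] [IsGalois E M]
    [IsGalois ℚ E], Module.finrank ℚ E = 2 → Module.finrank E M = 3 →
    ∀ (hQ : isCompact_glFiniteIntegralLevel 2 ℚ) (hE : isCompact_glFiniteIntegralLevel 2 E)
      (hM : isCompact_glFiniteIntegralLevel 2 M) (π : CuspidalAutomorphicRepData 2 ℚ hQ)
      (PiE : CuspidalAutomorphicRepData 2 E hE) (P : CuspidalAutomorphicRepData 2 M hM),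
      IsWeakBaseChangeLiftAE π.1 PiE.1 → IsWeakBaseChangeLiftAE PiE.1 P.1 →
      P.1.HasArchParameter (fun _ ↦ ({0, 0} : Multiset ℂ)) →
      π.1.HasArchParameter (fun _ ↦ ({0, 0} : Multiset ℂ))

/-- **C6b — the top form has parameter zero.**  Over a TOTALLY COMPLEX `M`, a cuspidal `P` which is
`π(σ)` a.e. for an Artin `σ` of DIHEDRAL type (projective image of order `4` here: `σ_M`, `M ↔ V₄`)
has Harish-Chandra parameter `{0, 0}` at every embedding: `P ≃ AI(θ)` strongly (Jacquet–Langlands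
1970 §12 / strong multiplicity one), and at a complex place the components of `AI(θ)` are principal
series of finite-order — hence trivial — characters of `ℂ^×`.  This is "Prop. 4.1 at `∞`" for
MONOMIAL `σ` only, where strong automorphy is classical; the tree's road needs it for the octahedral
`σ` itself (hypothesis `hpair` of `exists_isNewform1_of_isPiOfArtinRep_of_pair`). (L, named-fact
level) [cite: JacquetLanglands1970, §12] [cite: Gelbart1997, Prop. 4.1] -/
def SigArchParamTop : Prop :=
  ∀ (M : Type) [Field M] [NumberField M], (∀ τ : M →+* ℂ, ∃ x : M, (τ x).im ≠ 0) →
    ∀ (σ : FramedArtinRep M 2), Nat.card (projectiveImage σ.toMonoidHom) = 4 →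
    ∀ (hM : isCompact_glFiniteIntegralLevel 2 M) (P : CuspidalAutomorphicRepData 2 M hM),
      IsPiOfArtinRep σ P.1 → P.1.HasArchParameter (fun _ ↦ ({0, 0} : Multiset ℂ))

/-- **C7 — weight one for a BLIND `π(σ)`.**  For `σ : Γ_ℚ → GL₂(ℂ)` odd and `π` cuspidal with
`IsCubicBlindPiOfArtinRep σ π` and Harish-Chandra parameter `{0, 0}`, `π` is of weight one
(`AutomorphicRepData.IsOfWeightOne`: parameter `{0,0}` and `-1_∞` acts by `-1`).  Route (M): the
tree's `IsPiOfArtinRep.rightTranslation_ofArch_neg_one_add_mem` (central character `= det σ`, then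
`det σ(c) = -1`) uses `IsPiOfArtinRep` ONLY through the constant coefficient `∏ t_{π,v} = det σ(Frob_v)`
a.e. (`exists_centralCharacter_eq_det`), which the blind relation preserves (`z z' = 1`). -/
def SigIsOfWeightOneOfBlind : Prop :=
  ∀ (hcpt : isCompact_glFiniteIntegralLevel 2 ℚ) (σ : FramedArtinRep ℚ 2)
    (π : CuspidalAutomorphicRepData 2 ℚ hcpt), σ.IsOdd → IsCubicBlindPiOfArtinRep σ π.1 →
      π.1.HasArchParameter (fun _ ↦ ({0, 0} : Multiset ℂ)) → π.1.IsOfWeightOne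

/-! ### C8: the endgame — newform vs `ρ̄` modulo `𝔓 ∣ 3` -/

/-- **C8 — a weight-one newform attached to a blind `π(Ψ ∘ ρ̄)` makes `ρ̄` modular.**  `f` is the
newform of the weight-one dictionary for `π` (Satake polynomial `=` Hecke polynomial at every
`p ∤ N`, the conclusion of the tree's PROVED `hdesc` direction
`IsOfWeightOne.exists_isNewform1_of_exists_fixed` + `exists_gammaOneFiniteLevel_fixed`), and `π` is
blind-`π(σ)` for `σ = modThreeLift ρ`.  Route (M): Deligne–Serre (`exists_complexGaloisRep_of_weight_one`,
leaf `thm61`, already in the cone) gives `ρ_f` with `charpoly ρ_f(Frob_p) =` Hecke polynomial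
(`p ∤ N`); by C1b its reduction mod `𝔓 ∣ (1 + √-2)` equals `charpoly ρ̄(Frob_p)` for a.e. `p`
(`Ψ ≡ id mod 𝔭`, as in `isModular_of_isAbsolutelyIrreducible_of_isOdd_of_langlands_tunnell`);
Chebotarev (`absoluteGaloisGroup.frobenius_dense`, `chebotarev_artinRep_holds`, PROVED) and
Brauer–Nesbitt (`brauerNesbitt_holds`, PROVED) give `ρ̄_f^{ss} ≃ ρ̄ ⊗ k(𝔓)`, whence unramifiedness
and the characteristic polynomials at EVERY `p ∤ 3N` (`ker_le_ker_of_equiv`). -/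
def SigIsModularOfBlindNewform : Prop :=
  ∀ (hcpt : isCompact_glFiniteIntegralLevel 2 ℚ) (ρ : ModPGaloisRep ℚ (ZMod 3) 2)
    (π : CuspidalAutomorphicRepData 2 ℚ hcpt), FramedRep.IsAbsolutelyIrreducible ρ →
    IsCubicBlindPiOfArtinRep (modThreeLift ρ) π.1 →
    ∀ (N : ℕ) [NeZero N] (f : CuspForm (Gamma1 N) 1), IsNewform1 f →
      (∀ v : HeightOneSpectrum (𝓞 ℚ), ¬ ((primesEquiv v : Nat.Primes) : ℕ) ∣ N →
          ∃ α : Multiset ℂ, π.1.HasSatakeParamAt v α ∧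
            satakePolynomial α =
              (EllipticCurves.ModularForms.heckePolynomial f (primesEquiv v : Nat.Primes)).map
                (algebraMap (coeffCharField f) ℂ)) →
      ρ.IsModular

/-! ### The road's upstream output and the end-assembly (PROVED composition) -/

/-- **PLAN C, Steps 1–3 (the descent chain), as one statement for the surjective cell:** for an
odd absolutely irreducible `ρ̄` with `σ = Ψ ∘ ρ̄` octahedral (projective image of order `24`) there
is a cuspidal `π` on `GL₂(𝔸_ℚ)` which is blind-`π(σ)` and has archimedean parameter `{0, 0}`.
Inputs: `automorphicInduction_character`, `exists_cuspidal_descent_det_cubic`, C3 (`ℓ = 2, 3`), C4,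
`cuspidal_descent_cyclic`, `exists_twist_quadraticSign` (PROVED), JPSS81 re-typed (`hb'`), C5, C2,
C6a, C6b — and NOT `GelbartJacquet_adjoint_lift`, `JacquetShalika_eq_of_rsData_eq`, `hpair`. -/
def SigBlindRoadOutput : Prop :=
  ∀ (ρ : ModPGaloisRep ℚ (ZMod 3) 2), FramedRep.IsAbsolutelyIrreducible ρ → FramedGaloisRep.IsOdd ρ →
    Nat.card (projectiveImage (modThreeLift ρ).toMonoidHom) = 24 →
    ∃ (hcpt : isCompact_glFiniteIntegralLevel 2 ℚ) (π : CuspidalAutomorphicRepData 2 ℚ hcpt),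
      IsCubicBlindPiOfArtinRep (modThreeLift ρ) π.1 ∧
        π.1.HasArchParameter (fun _ ↦ ({0, 0} : Multiset ℂ))

/-- **End-assembly of PLAN C (PROVED, pure composition).**  Blind road output + C7 + the tree's
weight-one dictionary (`hdesc`, written out as in `conductorFree_of_isOfWeightOne`; supplied in the
tree by `IsOfWeightOne.exists_isNewform1_of_exists_fixed` and `exists_gammaOneFiniteLevel_fixed`)
+ C8 ⇒ the surjective (octahedral) cell of `stub_modThree`. -/
theorem isModular_surj_of_planC (hroad : SigBlindRoadOutput) (hw1 : SigIsOfWeightOneOfBlind)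
    (hdesc : ∀ (hcpt : isCompact_glFiniteIntegralLevel 2 ℚ) (π : CuspidalAutomorphicRepData 2 ℚ hcpt),
      π.1.IsOfWeightOne →
        ∃ (N : ℕ) (_ : NeZero N) (f : CuspForm (Gamma1 N) 1), IsNewform1 f ∧
          ∀ v : HeightOneSpectrum (𝓞 ℚ), ¬ ((primesEquiv v : Nat.Primes) : ℕ) ∣ N →
            ∃ α : Multiset ℂ, π.1.HasSatakeParamAt v α ∧
              satakePolynomial α =
                (EllipticCurves.ModularForms.heckePolynomial f (primesEquiv v : Nat.Primes)).map
                  (algebraMap (coeffCharField f) ℂ))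
    (hend : SigIsModularOfBlindNewform)
    (W : WeierstrassCurve ℚ) [W.IsElliptic] (ρ : ModPGaloisRep ℚ (ZMod 3) 2)
    (hρ : W.IsTorsionGaloisRep 3 ρ) (habs : FramedRep.IsAbsolutelyIrreducible ρ)
    (h24 : Nat.card (projectiveImage (modThreeLift ρ).toMonoidHom) = 24) : ρ.IsModular := by
  haveI : Fact (Nat.Prime 3) := ⟨Nat.prime_three⟩
  haveI : NeZero ((3 : ℕ) : ℚ) := ⟨by norm_num⟩
  have hodd : FramedGaloisRep.IsOdd ρ := by
    intro φ c hc
    rw [W.det_eq_modPCyclotomicCharacter_of_isTorsionGaloisRep_holds 3 ρ hρ c]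
    ext
    rw [modPCyclotomicCharacterZMod_eq_modNCyclotomicCharacter,
      modNCyclotomicCharacter_of_isComplexConjugation hc, Units.val_neg, Units.val_one]
  obtain ⟨hcpt, π, hblind, harch⟩ := hroad ρ habs hodd h24
  have hweight : π.1.IsOfWeightOne :=
    hw1 hcpt (modThreeLift ρ) π (isOdd_modThreeLift hodd) hblind harch
  obtain ⟨N, hN, f, hf, hsat⟩ := hdesc hcpt π hweight
  exact hend hcpt ρ π habs hblind N f hf hsat

end Summit.ABC.ABC.Cruxes.FreyModularity.StubModThreeIdeasK2G17

end
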